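import Summits.QuantumFields.YangMills.Theorems.EntropyBudgetEquipartitionBudgetRate
import Literature.MathematicalPhysics.QuantumFieldTheory.Balaban1983to89.InfiniteVolumeSufficientIII
import Literature.MathematicalPhysics.QuantumLattice.TorusWilsonGibbs
import Mathlib.MeasureTheory.Integral.IntervalIntegral.FundThmCalculus
import Mathlib.Probability.Moments.Tilted
import HarnessLib

/-!
# Route `EntropyBudgetEquipartition`, crux `EntropyBudgetTransfer` (stmt-QuantumFields-22401) — helper «specific-heat sum rule with a power rate»

HONEST LABEL: a helper toward a RECORD-label rung (R2ξ-G); nothing here bears on the Yang–Mills mass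
gap itself.

What the free-energy RATE (crux `FreeEnergyRate`, K1 — closed in the tree, `freeEnergyRate_proof`) buys
at SECOND order. On the torus `Λ_{L+1} = (ℤ/(L+1)ℤ)⁴` the pressure `p_L(t) = |Λ|⁻¹ log Z_{Λ,t}` is the
normalised cumulant generating function of `−S_W` under product Haar measure (tree
`wilsonMeasure_eq_tilted_pi`), so `p_L'(t) = −|Λ|⁻¹⟨S_W⟩_{t,L+1}` and `p_L''(t) = |Λ|⁻¹ Var_{t,L+1}(S_W)`
— the SPECIFIC HEAT per site (Mathlib `integral_tilted_mul_self`, `variance_tilted_mul`). Hence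

* `integral_variance_wilsonAction_eq` — the integrated sum rule
  `∫_β^{β'} Var_{t,L+1}(S_W) dt = ⟨S_W⟩_{β,L+1} − ⟨S_W⟩_{β',L+1}` (every `β, β'`, every torus), and per
  site `∫_β^{β'} |Λ|⁻¹ Var_{t,L+1}(S_W) dt = ⟨s₀⟩_{β,L+1} − ⟨s₀⟩_{β',L+1}` (`s₀` = Wilson energy of the six
  plaquettes at the origin; translation invariance, tree `Equipartition.wilsonExpectation_wilsonAction_eq`);
  `continuous_variance_wilsonAction` — the specific heat is continuous in the coupling;
* `specificHeat_sumRule_of_rate` — K1's body `|f_r(β) + (3D/2) log β − K| ≤ C β^{−κ}` forces (through the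
  sibling `BudgetRate.budgetRate_torus`: `|β⟨s₀⟩_{β,L+1} − 3D/2| ≤ C' β^{−κ/2}` eventually in `L`) for
  `β₁ ≤ β ≤ β'`, eventually in `L`,
  `|∫_β^{β'} |Λ|⁻¹ Var_{t,L+1}(S_W) dt − (3D/2)(1/β − 1/β')| ≤ C' (β^{−(1+κ/2)} + β'^{−(1+κ/2)})`:
  the β-INTEGRATED specific heat has the free-gluon (equipartition) value `∫ (3D/2) t⁻² dt` up to a power;
* sequel `EntropyBudgetEquipartitionSpecificHeatEquipartition.lean`: K1's body forces, for `β ≥ β₂` and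
  eventually in `L`, a coupling `t ∈ [β, β + β·β^{−κ/4}]` with `|t² |Λ|⁻¹ Var_{t,L+1}(S_W) − 3D/2| ≤ C'' β^{−κ/4}`
  (equipartition of the specific heat with a power rate at a nearby coupling); the UNCONDITIONAL forms
  (every compact simple `G`, via the closed crux) are in `EntropyBudgetEquipartitionSpecificHeatSumRuleAllGroups.lean`
  (kept apart so that this file does not sit above a route file).

Reading for item 22401 (numbers, not adjectives): `|Λ|⁻¹ Var(S_W) = Σ_y Cov(s₀, s_y)` is the two-plaquette
covariance SUMMED over all separations and planes; K1 pins it to `3D/(2β²)` only after summing over the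
separation AND averaging over a window of couplings — the crux asks for the law at each separation
`n ≤ 2β^A`, which is where the local-Gaussianity wall (items 8937/8938) sits. The tree's hypothesis-free
`BalabanLadderNTCouplingSumRuleBudget` has the one-sided chessboard budget `∫_{β₁}^{β₂} χ_L ≤ 6K(1+log β₁)/β₁`;
this file gives both sides with the equipartition constant.

References: S. Friedli, Y. Velenik, *Statistical Mechanics of Lattice Systems*, CUP 2017, §3.2 and
Thm. B.12 (pressure as a cumulant generating function; convexity); S. Chatterjee, arXiv:1602.01222 (the
rate's source); E. Seiler, LNP 159 (1982) Ch. 2. [FriedliVelenik2017] [arXiv160201222] [SeilerLNP1982]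
-/

noncomputable section

namespace Summit.QuantumFields.YangMills.Theorems.EntropyBudgetEquipartition.SpecificHeat

open MeasureTheory ProbabilityTheory Filter Topology Set
open Literature.MathematicalPhysics.QuantumLattice Literature.MathematicalPhysics.QuantumFieldTheory

/-! ### Abstract layer: the cumulant generating function of a bounded variable -/

section Abstract

variable {Ω : Type*} [MeasurableSpace Ω] {μ : Measure Ω} [IsProbabilityMeasure μ] {X : Ω → ℝ} {C : ℝ}

/-- For a bounded measurable `X` every real `t` is interior to the domain of the moment generating
function. [folklore] -/
theorem mem_interior_integrableExpSet (hX : Measurable X) (hC : ∀ ω, |X ω| ≤ C) (t : ℝ) :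
    t ∈ interior (integrableExpSet X μ) := by
  have hI : integrableExpSet X μ = Set.univ := Set.eq_univ_of_forall fun s =>
    Literature.Probability.LatticeModels.ForbiddenGap.integrable_exp_mul_of_abs_le hX hC s
  rw [hI, interior_univ]
  exact mem_univ t

/-- The cumulant generating function of a bounded measurable variable is smooth on `ℝ` (it is
analytic, Mathlib `analyticAt_cgf`). [folklore] -/
theorem contDiff_cgf (hX : Measurable X) (hC : ∀ ω, |X ω| ≤ C) {n : WithTop ℕ∞} :
    ContDiff ℝ n (cgf X μ) :=
  AnalyticOnNhd.contDiff fun t _ => analyticAt_cgf (mem_interior_integrableExpSet hX hC t)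

/-- **`cgf'' = tilted variance`, derivative form.** For bounded measurable `X`, the Gibbs mean
`t ↦ ∫ X d(μ tilted by tX) = (cgf X μ)'(t)` is differentiable with derivative the tilted variance
`Var[X; μ.tilted (t X)]` (Mathlib `integral_tilted_mul_self`, `variance_tilted_mul`). [cite: FriedliVelenik2017, §3.2] -/
theorem hasDerivAt_integral_tilted (hX : Measurable X) (hC : ∀ ω, |X ω| ≤ C) (t : ℝ) :
    HasDerivAt (fun s : ℝ => ∫ ω, X ω ∂(μ.tilted fun ω => s * X ω))
      (Var[X; μ.tilted fun ω => t * X ω]) t := by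
  have hmem := fun s => mem_interior_integrableExpSet (μ := μ) hX hC s
  have hfun : (fun s : ℝ => ∫ ω, X ω ∂(μ.tilted fun ω => s * X ω)) = deriv (cgf X μ) := by
    funext s; exact integral_tilted_mul_self (hmem s)
  rw [hfun, variance_tilted_mul (hmem t), iteratedDeriv_succ, iteratedDeriv_one]
  have hd : Differentiable ℝ (iteratedDeriv 1 (cgf X μ)) :=
    (contDiff_cgf (μ := μ) hX hC (n := 2)).differentiable_iteratedDeriv 1 (by norm_num)
  rw [iteratedDeriv_one] at hd
  exact (hd t).hasDerivAt

/-- The tilted variance `t ↦ Var[X; μ.tilted (t X)]` of a bounded measurable `X` is continuous in the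
tilt (it is `cgf''`). [folklore] -/
theorem continuous_variance_tilted (hX : Measurable X) (hC : ∀ ω, |X ω| ≤ C) :
    Continuous fun t : ℝ => Var[X; μ.tilted fun ω => t * X ω] := by
  have hfun : (fun t : ℝ => Var[X; μ.tilted fun ω => t * X ω]) = iteratedDeriv 2 (cgf X μ) := by
    funext t; exact variance_tilted_mul (mem_interior_integrableExpSet hX hC t)
  rw [hfun]
  exact (contDiff_cgf (μ := μ) hX hC (n := 2)).continuous_iteratedDeriv 2 le_rfl

/-- **Integrated sum rule (abstract).** For bounded measurable `X` and all real `a, b`,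
`∫_a^b Var[X; μ.tilted (tX)] dt = ∫ X d(μ.tilted (bX)) − ∫ X d(μ.tilted (aX))` (fundamental theorem of
calculus for `cgf'`). [cite: FriedliVelenik2017, §3.2] -/
theorem integral_variance_tilted_eq (hX : Measurable X) (hC : ∀ ω, |X ω| ≤ C) (a b : ℝ) :
    ∫ t in a..b, Var[X; μ.tilted fun ω => t * X ω] =
      (∫ ω, X ω ∂(μ.tilted fun ω => b * X ω)) - ∫ ω, X ω ∂(μ.tilted fun ω => a * X ω) :=
  intervalIntegral.integral_eq_sub_of_hasDerivAt (fun t _ => hasDerivAt_integral_tilted hX hC t)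
    ((continuous_variance_tilted hX hC).intervalIntegrable a b)

end Abstract

/-! ### The torus: specific heat = `β`-derivative of minus the mean action -/

section Torus

variable {d N : ℕ} {G : Type} [Group G] [TopologicalSpace G] [IsTopologicalGroup G] [CompactSpace G]
  [MeasurableSpace G] [BorelSpace G] [SecondCountableTopology G]
  (ρ : G →* Matrix (Fin N) (Fin N) ℂ)

/-- The torus Wilson state at coupling `t` is product Haar measure tilted by `t · (−S_W)` (tree
`wilsonMeasure_eq_tilted_pi`, rewritten in Mathlib's `μ.tilted (t * X ·)` form with `X = −S_W`). [folklore] -/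
theorem wilsonMeasure_eq_tilted_neg {M : ℕ} [NeZero M] (hρ : Continuous ρ) (t : ℝ) :
    wilsonMeasure (d := d) (L := M) ρ t =
      (Measure.pi fun _ : Edge d M => haarProbability G).tilted
        fun U => t * (fun V : GaugeConfig d M G => -wilsonAction ρ V) U := by
  rw [wilsonMeasure_eq_tilted_pi ρ hρ t]
  congr 1
  funext U
  ring

/-- **The specific heat is continuous in the coupling**: `t ↦ Var_{t,M}(S_W)` is continuous on `ℝ`
(it is the second derivative of the analytic torus pressure). [folklore] -/
theorem continuous_variance_wilsonAction {M : ℕ} [NeZero M] (hρ : Continuous ρ) :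
    Continuous fun t : ℝ =>
      Var[wilsonAction (d := d) (L := M) (G := G) ρ; wilsonMeasure (d := d) (L := M) ρ t] := by
  obtain ⟨B, hB⟩ := exists_abs_wilsonAction_le (d := d) (L := M) ρ hρ
  have hX : Measurable fun V : GaugeConfig d M G => -wilsonAction ρ V :=
    (measurable_wilsonAction ρ hρ).neg
  have hXb : ∀ V : GaugeConfig d M G, |(-wilsonAction ρ V)| ≤ B := fun V => by
    rw [abs_neg]; exact hB V
  have h := continuous_variance_tilted (μ := Measure.pi fun _ : Edge d M => haarProbability G) hX hXb
  refine h.congr fun t => ?_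
  rw [← wilsonMeasure_eq_tilted_neg ρ hρ t]
  exact variance_fun_neg

/-- **Integrated sum rule on the torus.** For every continuous representation, every torus side `M`
and all couplings `β, β'`: `∫_β^{β'} Var_{t,M}(S_W) dt = ⟨S_W⟩_{β,M} − ⟨S_W⟩_{β',M}` — the specific heat is
the `β`-derivative of minus the mean Wilson action. [cite: FriedliVelenik2017, §3.2] -/
theorem integral_variance_wilsonAction_eq {M : ℕ} [NeZero M] (hρ : Continuous ρ) (β β' : ℝ) :
    ∫ t in β..β', Var[wilsonAction (d := d) (L := M) (G := G) ρ; wilsonMeasure (d := d) (L := M) ρ t] =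
      wilsonExpectation (L := M) ρ β (wilsonAction (d := d) (L := M) (G := G) ρ) -
        wilsonExpectation (L := M) ρ β' (wilsonAction (d := d) (L := M) (G := G) ρ) := by
  obtain ⟨B, hB⟩ := exists_abs_wilsonAction_le (d := d) (L := M) ρ hρ
  have hX : Measurable fun V : GaugeConfig d M G => -wilsonAction ρ V :=
    (measurable_wilsonAction ρ hρ).neg
  have hXb : ∀ V : GaugeConfig d M G, |(-wilsonAction ρ V)| ≤ B := fun V => by
    rw [abs_neg]; exact hB V
  have h := integral_variance_tilted_eq (μ := Measure.pi fun _ : Edge d M => haarProbability G)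
    hX hXb β β'
  have hV : ∀ t : ℝ, Var[fun V : GaugeConfig d M G => -wilsonAction ρ V;
      (Measure.pi fun _ : Edge d M => haarProbability G).tilted
        fun U => t * (fun V : GaugeConfig d M G => -wilsonAction ρ V) U] =
      Var[wilsonAction (d := d) (L := M) (G := G) ρ; wilsonMeasure (d := d) (L := M) ρ t] := by
    intro t
    rw [← wilsonMeasure_eq_tilted_neg ρ hρ t]
    exact variance_fun_neg
  have hE : ∀ t : ℝ, (∫ V, (fun V : GaugeConfig d M G => -wilsonAction ρ V) V
      ∂((Measure.pi fun _ : Edge d M => haarProbability G).tilted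
        fun U => t * (fun V : GaugeConfig d M G => -wilsonAction ρ V) U)) =
      -wilsonExpectation (L := M) ρ t (wilsonAction (d := d) (L := M) (G := G) ρ) := by
    intro t
    rw [← wilsonMeasure_eq_tilted_neg ρ hρ t]
    unfold wilsonExpectation
    exact integral_neg _
  simp only [hV, hE] at h
  rw [h]
  ring

/-- **Integrated sum rule per site**, in the vocabulary of item 22401 / `BudgetRate`: on the torus of
side `M`, `∫_β^{β'} M^{−d} Var_{t,M}(S_W) dt = ⟨s₀⟩_{β,M} − ⟨s₀⟩_{β',M}`, `s₀` the Wilson energy of the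
plaquettes based at the origin of `ℤ^d` read on periodic configurations (translation invariance, tree
`Equipartition.wilsonExpectation_wilsonAction_eq`). [cite: FriedliVelenik2017, §3.2] -/
theorem integral_variance_perSite_eq {M : ℕ} [NeZero M] (hρ : Continuous ρ) (β β' : ℝ) :
    ∫ t in β..β', ((M : ℝ) ^ d)⁻¹ *
        Var[wilsonAction (d := d) (L := M) (G := G) ρ; wilsonMeasure (d := d) (L := M) ρ t] =
      wilsonExpectation (L := M) ρ β (toTorusObservable M fun U : LGConfig d G =>
          ∑ i : Fin d, ∑ j : Fin d, if i < j then ((N : ℝ) - plaquetteObs ρ 0 i j U) else 0) -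
        wilsonExpectation (L := M) ρ β' (toTorusObservable M fun U : LGConfig d G =>
          ∑ i : Fin d, ∑ j : Fin d, if i < j then ((N : ℝ) - plaquetteObs ρ 0 i j U) else 0) := by
  have hM : (0 : ℝ) < (M : ℝ) ^ d := pow_pos (Nat.cast_pos.2 (Nat.pos_of_ne_zero (NeZero.ne M))) d
  rw [intervalIntegral.integral_const_mul, integral_variance_wilsonAction_eq ρ hρ β β',
    EquipartitionPinsProbe.Equipartition.toTorusObservable_siteEnergy ρ M,
    EquipartitionPinsProbe.Equipartition.wilsonExpectation_wilsonAction_eq ρ hρ β M,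
    EquipartitionPinsProbe.Equipartition.wilsonExpectation_wilsonAction_eq ρ hρ β' M,
    ← mul_sub, inv_mul_cancel_left₀ hM.ne']

end Torus

/-! ### The sum rule with a power rate (`d = 4`) -/

section Rate

variable {G : Type} [Group G] [TopologicalSpace G] [IsTopologicalGroup G] [CompactSpace G]
  [MeasurableSpace G] [BorelSpace G]

/-- Dividing a first-moment budget by the coupling: `|β e − a| ≤ C' β^{−κ/2}`, `β > 0`, gives
`|e − a/β| ≤ C' β^{−(1+κ/2)}`. [folklore] -/
theorem abs_sub_div_le_of_budget {β e a C' κ : ℝ} (hβ : 0 < β)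
    (h : |β * e - a| ≤ C' * β ^ (-(κ / 2))) : |e - a / β| ≤ C' * β ^ (-(1 + κ / 2)) := by
  have hfac : e - a / β = β⁻¹ * (β * e - a) := by field_simp
  have hpow : β ^ (-(1 + κ / 2)) = β⁻¹ * β ^ (-(κ / 2)) := by
    rw [show (-(1 + κ / 2) : ℝ) = -1 + -(κ / 2) by ring, Real.rpow_add hβ, Real.rpow_neg_one]
  rw [hfac, abs_mul, abs_of_pos (inv_pos.2 hβ), hpow, ← mul_assoc, mul_comm C' β⁻¹, mul_assoc]
  exact mul_le_mul_of_nonneg_left h (inv_pos.2 hβ).le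

/-- **Specific-heat sum rule with a power rate (conditional form).** A free-energy rate
`|f_r(β) + (3D/2) log β − K| ≤ C β^{−κ}` (`β ≥ β₀`; the body of crux `FreeEnergyRate`) forces: there are
`C', β₁ > 0` such that for all `β₁ ≤ β ≤ β'`, eventually along the tori `Λ_{L+1}`,
`|∫_β^{β'} |Λ_{L+1}|⁻¹ Var_{t,L+1}(S_W) dt − (3D/2)(1/β − 1/β')| ≤ C' (β^{−(1+κ/2)} + β'^{−(1+κ/2)})` — the
`β`-integrated specific heat per site takes the free-gluon equipartition value up to a power
(`integral_variance_perSite_eq` and the budget rate `BudgetRate.budgetRate_torus` at the two endpoints). [cite: FriedliVelenik2017, §3.2 and Thm. 3.34] -/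
theorem specificHeat_sumRule_of_rate (r : LatticeRep G) {D : ℕ} {K κ C β₀ : ℝ} (hκ : 0 < κ)
    (hrate : ∀ β : ℝ, β₀ ≤ β →
      |freeEnergyDensity 4 r.ρ β + (3 * (D : ℝ) / 2) * Real.log β - K| ≤ C * β ^ (-κ)) :
    ∃ C' β₁ : ℝ, 0 < β₁ ∧ ∀ β β' : ℝ, β₁ ≤ β → β ≤ β' → ∀ᶠ L : ℕ in atTop,
      |(∫ t in β..β', (((L + 1 : ℕ) : ℝ) ^ 4)⁻¹ *
          Var[wilsonAction (d := 4) (L := L + 1) (G := G) r.ρ;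
            wilsonMeasure (d := 4) (L := L + 1) r.ρ t]) -
          (3 * (D : ℝ) / 2) * (1 / β - 1 / β')| ≤
        C' * (β ^ (-(1 + κ / 2)) + β' ^ (-(1 + κ / 2))) := by
  haveI : SecondCountableTopology (Matrix (Fin r.N) (Fin r.N) ℂ) :=
    inferInstanceAs (SecondCountableTopology (Fin r.N → Fin r.N → ℂ))
  haveI : SecondCountableTopology G :=
    (r.continuous.isClosedEmbedding r.injective).isEmbedding.secondCountableTopology
  obtain ⟨C', β₁, h⟩ := BudgetRate.budgetRate_torus r hκ hrate
  refine ⟨C', max β₁ 1, lt_of_lt_of_le one_pos (le_max_right _ _), fun β β' hβ hββ' => ?_⟩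
  have hβ1 : β₁ ≤ β := (le_max_left _ _).trans hβ
  have hβ0 : 0 < β := lt_of_lt_of_le one_pos ((le_max_right _ _).trans hβ)
  have hβ'0 : 0 < β' := lt_of_lt_of_le hβ0 hββ'
  filter_upwards [h β hβ1, h β' (hβ1.trans hββ')] with L hL hL'
  rw [integral_variance_perSite_eq r.ρ r.continuous β β']
  set e : ℝ := wilsonExpectation (L := L + 1) r.ρ β (toTorusObservable (L + 1)
    fun U : LGConfig 4 G => ∑ i : Fin 4, ∑ j : Fin 4,
      if i < j then ((r.N : ℝ) - plaquetteObs r.ρ 0 i j U) else 0) with he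
  set e' : ℝ := wilsonExpectation (L := L + 1) r.ρ β' (toTorusObservable (L + 1)
    fun U : LGConfig 4 G => ∑ i : Fin 4, ∑ j : Fin 4,
      if i < j then ((r.N : ℝ) - plaquetteObs r.ρ 0 i j U) else 0) with he'
  have h1 := abs_sub_div_le_of_budget hβ0 hL
  have h2 := abs_sub_div_le_of_budget hβ'0 hL'
  have hsplit : e - e' - 3 * (D : ℝ) / 2 * (1 / β - 1 / β') =
      (e - 3 * (D : ℝ) / 2 / β) - (e' - 3 * (D : ℝ) / 2 / β') := by ring
  rw [hsplit, mul_add]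
  exact (abs_sub _ _).trans (add_le_add h1 h2)

end Rate

end Summit.QuantumFields.YangMills.Theorems.EntropyBudgetEquipartition.SpecificHeat

end
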